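import Literature.NumberTheory.Sieve.LinearFormsPairSieve
import Literature.NumberTheory.Sieve.PairShiuDecomposition
import HarnessLib

/-!
# Counting `n ≤ N` with `c₁ ∣ n`, `c₂ ∣ mn + h` and both cofactors free of small odd primes

Topic `Literature/NumberTheory/Sieve`. Everything here is PROVED; no definition is introduced.
This is the counting step of the bivariate Brun–Titchmarsh / Nair–Tenenbaum bound for the pair
of linear forms `(n, mn + h)` (Matomäki–Merikoski, arXiv:2112.11412, Lemma 3.1, there from
Henriot's theorem): for `c₁, c₂ ≥ 1`, an odd squarefree `P ∣ P(w)` and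

`D = {1 ≤ n ≤ N : c₁ ∣ n, c₂ ∣ mn + h, (n/c₁, P) = 1, ((mn+h)/c₂, P) = 1}`,

if `D ≠ ∅` then (`PairShiuCount.card_le`)

`#D ≤ C₀ (N·(mc₁, c₂)/(c₁c₂) + 1) ∏_{p ∣ P}(1 − 2/p) ∏_{p ∣ P, p ∣ hmc₁c₂} (p−1)/(p−2) + C₀ w^{19} log² w`

with the absolute `C₀` of `PairLinSieve.card_coprime_le_generic`. Proof: `n/c₁` runs over an
arithmetic progression modulo `q = c₂/(mc₁, c₂)`; along it `n/c₁` and `(mn+h)/c₂` are two integral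
linear forms in the progression variable, to which the two-dimensional sieve of
`LinearFormsPairSieve.lean` applies; non-degeneracy of the forms at the primes of `P` is read off
from any one element of `D`.

## References

* K. Matomäki, J. Merikoski, IMRN 2023 (arXiv:2112.11412), Lemma 3.1. [cite: MatomakiMerikoski2023, Lemma 3.1]
* H. Halberstam, H.-E. Richert, *Sieve Methods* (1974), Thm 2.5. [cite: HalberstamRichert1974, Thm 2.5]
-/

noncomputable section

open Finset Real Polynomial

namespace Literature.NumberTheory.Sieve

namespace PairShiuCount

/-- **Counting the fibre over `(c₁, c₂)`.** With the absolute `C₀` of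
`PairLinSieve.card_coprime_le_generic`: for `c₁, c₂, m, h ≥ 1`, `w ≥ 2`, an odd squarefree
`P ∣ P(w)`, and `D = {1 ≤ n ≤ N : c₁ ∣ n, c₂ ∣ mn+h, (n/c₁, P) = 1, ((mn+h)/c₂, P) = 1}` non-empty,
`#D ≤ C₀ (N (mc₁,c₂)/(c₁c₂) + 1) ∏_{p ∣ P}(1 − 2/p) ∏_{p ∣ P, p ∣ hmc₁c₂} (p−1)/(p−2) + C₀ w^{19} log² w`.
[cite: MatomakiMerikoski2023, Lemma 3.1] -/
theorem card_le :
    ∃ C₀ : ℝ, 0 < C₀ ∧ ∀ (N m h c₁ c₂ : ℕ) (w : ℝ) (P : ℕ), 2 ≤ w → P ∣ primesProdBelow w →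
      Odd P → 1 ≤ m → 1 ≤ h → 1 ≤ c₁ → 1 ≤ c₂ →
      ((Icc 1 N).filter fun n : ℕ => c₁ ∣ n ∧ c₂ ∣ m * n + h ∧ (n / c₁).Coprime P ∧
        ((m * n + h) / c₂).Coprime P).Nonempty →
      (#((Icc 1 N).filter fun n : ℕ => c₁ ∣ n ∧ c₂ ∣ m * n + h ∧ (n / c₁).Coprime P ∧
        ((m * n + h) / c₂).Coprime P) : ℝ) ≤
        C₀ * ((N : ℝ) * Nat.gcd (m * c₁) c₂ / ((c₁ : ℝ) * c₂) + 1) *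
            ((∏ p ∈ P.primeFactors, (1 - 2 / (p : ℝ))) *
              ∏ p ∈ P.primeFactors.filter (· ∣ h * m * c₁ * c₂), (((p : ℝ) - 1) / ((p : ℝ) - 2))) +
          C₀ * w ^ (19 : ℕ) * Real.log w ^ 2 := by
  obtain ⟨C₀, hC₀, hgen⟩ := PairLinSieve.card_coprime_le_generic
  refine ⟨C₀, hC₀, ?_⟩
  intro N m h c₁ c₂ w P hw hPw hPodd hm hh hc₁ hc₂ hne
  set D := (Icc 1 N).filter fun n : ℕ => c₁ ∣ n ∧ c₂ ∣ m * n + h ∧ (n / c₁).Coprime P ∧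
    ((m * n + h) / c₂).Coprime P with hD
  have hmemD : ∀ n ∈ D, (1 ≤ n ∧ n ≤ N) ∧ c₁ ∣ n ∧ c₂ ∣ m * n + h ∧ (n / c₁).Coprime P ∧
      ((m * n + h) / c₂).Coprime P := fun n hn => by
    simpa [hD, Finset.mem_filter, Finset.mem_Icc] using hn
  -- the gcd and the reduced data
  set G := Nat.gcd (m * c₁) c₂ with hGdef
  have hG : 0 < G := Nat.gcd_pos_of_pos_right _ (by omega)
  obtain ⟨a, ha⟩ : G ∣ m * c₁ := Nat.gcd_dvd_left _ _
  obtain ⟨q, hq⟩ : G ∣ c₂ := Nat.gcd_dvd_right _ _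
  -- `ha : m * c₁ = G * a`, `hq : c₂ = G * q`
  have hq1 : 1 ≤ q := by
    rcases Nat.eq_zero_or_pos q with h0 | h0
    · rw [h0, mul_zero] at hq; omega
    · exact h0
  have ha1 : 1 ≤ a := by
    rcases Nat.eq_zero_or_pos a with h0 | h0
    · rw [h0, mul_zero] at ha
      have : 1 ≤ m * c₁ := Nat.one_le_iff_ne_zero.mpr (Nat.mul_ne_zero (by omega) (by omega))
      omega
    · exact h0
  have haq : a.Coprime q := by
    have h1 : Nat.gcd (G * a) (G * q) = G := by rw [← ha, ← hq]
    rw [Nat.gcd_mul_left] at h1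
    have : Nat.gcd a q = 1 := by
      have h2 : G * Nat.gcd a q = G * 1 := by rw [mul_one]; exact h1
      exact Nat.eq_of_mul_eq_mul_left hG h2
    exact this
  -- `G ∣ h`, read off from an element of `D`
  obtain ⟨n₀, hn₀⟩ := hne
  obtain ⟨⟨hn₀1, hn₀N⟩, ⟨d₀, hd₀⟩, hc₂n₀, hcop₁, hcop₂⟩ := hmemD n₀ hn₀
  have hGh : G ∣ h := by
    have h1 : G ∣ m * n₀ + h := (Dvd.intro q hq.symm).trans hc₂n₀
    have h2 : G ∣ m * n₀ := by
      rw [hd₀, ← mul_assoc, ha, mul_assoc]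
      exact Dvd.intro _ rfl
    exact (Nat.dvd_add_right h2).mp h1
  obtain ⟨h', hh'⟩ := hGh
  -- `hh' : h = G * h'`
  have hh'1 : 1 ≤ h' := by
    rcases Nat.eq_zero_or_pos h' with h0 | h0
    · rw [h0, mul_zero] at hh'; omega
    · exact h0
  -- the congruence on `d = n / c₁`
  have hkey : ∀ d : ℕ, c₂ ∣ m * (c₁ * d) + h ↔ q ∣ a * d + h' := by
    intro d
    have : m * (c₁ * d) + h = G * (a * d + h') := by
      rw [← mul_assoc, ha, hh']; ring
    rw [this, hq]
    exact Nat.mul_dvd_mul_iff_left hG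
  obtain ⟨r, hr1, hrq, hrsol, hrall⟩ := PairShiu.exists_rep (b := h') hq1 haq
  obtain ⟨b₀, hb₀⟩ := hrsol
  -- `hb₀ : a * r + h' = q * b₀`
  have hb₀1 : 1 ≤ b₀ := by
    rcases Nat.eq_zero_or_pos b₀ with h0 | h0
    · rw [h0, mul_zero] at hb₀; omega
    · exact h0
  -- structure of the elements of `D`
  have hstruct : ∀ n ∈ D, ∃ k : ℕ, n = c₁ * (r + q * k) ∧ k ≤ N / (c₁ * q) ∧
      (r + q * k).Coprime P ∧ (b₀ + a * k).Coprime P ∧ m * n + h = c₂ * (b₀ + a * k) := by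
    intro n hn
    obtain ⟨⟨hn1, hnN⟩, ⟨d, hd⟩, hc₂n, hcp₁, hcp₂⟩ := hmemD n hn
    have hd1 : 1 ≤ d := by
      rcases Nat.eq_zero_or_pos d with h0 | h0
      · rw [h0, mul_zero] at hd; omega
      · exact h0
    have hqd : q ∣ a * d + h' := (hkey d).mp (hd ▸ hc₂n)
    have hmod : d ≡ r [MOD q] := hrall d hqd
    -- `d = r + q k`
    have hrd : r ≤ d := by
      by_contra hlt
      push Not at hlt
      -- `d < r ≤ q` and `d ≡ r (mod q)` force `d = r` unless ... : since `1 ≤ d < r ≤ q`, the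
      -- residues `d mod q = d` and `r mod q ∈ {r, 0}` differ
      rw [Nat.ModEq] at hmod
      have hdq : d % q = d := Nat.mod_eq_of_lt (by omega)
      rcases hrq.lt_or_eq with hlt' | heq
      · rw [hdq, Nat.mod_eq_of_lt hlt'] at hmod; omega
      · rw [hdq, heq, Nat.mod_self] at hmod; omega
    have hqdvd : q ∣ d - r := (Nat.modEq_iff_dvd' hrd).mp hmod.symm
    obtain ⟨k, hk⟩ := hqdvd
    have hdk : d = r + q * k := by omega
    refine ⟨k, by rw [hd, hdk], ?_, ?_, ?_, ?_⟩
    · -- `k ≤ N / (c₁ q)`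
      have h1 : c₁ * (q * k) ≤ N := by
        have : c₁ * (q * k) ≤ c₁ * d := Nat.mul_le_mul_left _ (by omega)
        rw [← hd] at this
        omega
      rw [Nat.le_div_iff_mul_le (Nat.mul_pos (by omega) (by omega))]
      calc k * (c₁ * q) = c₁ * (q * k) := by ring
        _ ≤ N := h1
    · have : n / c₁ = r + q * k := by
        rw [hd, hdk, Nat.mul_div_cancel_left _ (by omega)]
      rw [← this]; exact hcp₁
    · have hval : m * n + h = c₂ * (b₀ + a * k) := by
        rw [hd, hdk, hh', hq]
        have : m * (c₁ * (r + q * k)) = G * a * (r + q * k) := by rw [← ha]; ring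
        rw [this]
        have : G * a * (r + q * k) + G * h' = G * (a * r + h') + G * a * q * k := by ring
        rw [this, hb₀]; ring
      have : (m * n + h) / c₂ = b₀ + a * k := by
        rw [hval, Nat.mul_div_cancel_left _ (by omega)]
      rw [← this]; exact hcp₂
    · rw [hd, hdk, hh', hq]
      have : m * (c₁ * (r + q * k)) = G * a * (r + q * k) := by rw [← ha]; ring
      rw [this]
      have : G * a * (r + q * k) + G * h' = G * (a * r + h') + G * a * q * k := by ring
      rw [this, hb₀]; ring
  -- the data of `n₀`
  obtain ⟨k₀, -, -, hk₀cp₁, hk₀cp₂, -⟩ := hstruct n₀ hn₀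
  -- primes of `P`
  have hPne : P ≠ 0 := by rintro rfl; exact (Nat.not_odd_zero hPodd).elim
  have hprimeP : ∀ p ∈ P.primeFactors, p.Prime ∧ p ∣ P := fun p hp =>
    ⟨Nat.prime_of_mem_primeFactors hp, Nat.dvd_of_mem_primeFactors hp⟩
  -- a prime of `P` dividing a number coprime to `P` is absurd
  have hnot : ∀ {p x : ℕ}, p ∈ P.primeFactors → x.Coprime P → ¬ p ∣ x := by
    intro p x hp hx hpx
    obtain ⟨hpp, hpP⟩ := hprimeP p hp
    have := Nat.dvd_gcd hpx hpP
    rw [hx.gcd_eq_one] at this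
    exact hpp.one_lt.ne' (Nat.dvd_one.mp this)
  -- the sieve, with `α₁ = q`, `β₁ = r - q`, `α₂ = a`, `β₂ = b₀ - a`, `E = h m c₁ c₂`
  set T : ℕ := N / (c₁ * q) + 1 with hT
  have hsieve := hgen (q : ℤ) ((r : ℤ) - q) (a : ℤ) ((b₀ : ℤ) - a) T w P (h * m * c₁ * c₂)
    hw hPw hPodd ?_ ?_ ?_ ?_ ?_
  rotate_left
  · -- non-degeneracy of `ℓ₁`
    intro p hp ⟨h1, h2⟩
    have h3 : (p : ℤ) ∣ (r : ℤ) := by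
      have : (r : ℤ) = ((r : ℤ) - q) + q := by ring
      rw [this]; exact dvd_add h2 h1
    have h4 : p ∣ r + q * k₀ :=
      Nat.dvd_add (Int.natCast_dvd_natCast.mp h3)
        (dvd_mul_of_dvd_left (Int.natCast_dvd_natCast.mp h1) _)
    exact hnot hp hk₀cp₁ h4
  · -- non-degeneracy of `ℓ₂`
    intro p hp ⟨h1, h2⟩
    have h3 : (p : ℤ) ∣ (b₀ : ℤ) := by
      have : (b₀ : ℤ) = ((b₀ : ℤ) - a) + a := by ring
      rw [this]; exact dvd_add h2 h1
    have h4 : p ∣ b₀ + a * k₀ :=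
      Nat.dvd_add (Int.natCast_dvd_natCast.mp h3)
        (dvd_mul_of_dvd_left (Int.natCast_dvd_natCast.mp h1) _)
    exact hnot hp hk₀cp₂ h4
  · -- generic primes
    intro p hp hpE
    obtain ⟨hpp, -⟩ := hprimeP p hp
    have hE : ∀ x : ℕ, x ∣ h * m * c₁ * c₂ → ¬ p ∣ x := fun x hx hpx => hpE (hpx.trans hx)
    refine ⟨?_, ?_, ?_⟩
    · rw [Int.natCast_dvd_natCast]
      exact hE q ⟨h * m * c₁ * G, by rw [hq]; ring⟩
    · rw [Int.natCast_dvd_natCast]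
      exact hE a ⟨h * c₂ * G, by
        calc h * m * c₁ * c₂ = h * c₂ * (m * c₁) := by ring
          _ = h * c₂ * (G * a) := by rw [ha]
          _ = a * (h * c₂ * G) := by ring⟩
    · have : (q : ℤ) * ((b₀ : ℤ) - a) - (a : ℤ) * ((r : ℤ) - q) = (h' : ℤ) := by
        have hb₀' : ((a * r + h' : ℕ) : ℤ) = ((q * b₀ : ℕ) : ℤ) := by rw [hb₀]
        push_cast at hb₀'
        linear_combination -hb₀'
      rw [this, Int.natCast_dvd_natCast]
      exact hE h' ⟨G * m * c₁ * c₂, by rw [hh']; ring⟩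
  · -- primes dividing `E`: the slopes are coprime
    intro p hp _ ⟨h1, h2⟩
    obtain ⟨hpp, -⟩ := hprimeP p hp
    rw [Int.natCast_dvd_natCast] at h1 h2
    have := Nat.dvd_gcd h2 h1
    rw [haq.gcd_eq_one] at this
    exact hpp.one_lt.ne' (Nat.dvd_one.mp this)
  · -- positivity
    intro t ht1 _
    constructor
    · have : (q : ℤ) * t + ((r : ℤ) - q) = (q : ℤ) * ((t : ℤ) - 1) + r := by ring
      rw [this]
      have h1 : (0 : ℤ) ≤ (q : ℤ) * ((t : ℤ) - 1) :=
        mul_nonneg (by positivity) (sub_nonneg.mpr (by exact_mod_cast ht1))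
      have h2 : (1 : ℤ) ≤ r := by exact_mod_cast hr1
      linarith
    · have : (a : ℤ) * t + ((b₀ : ℤ) - a) = (a : ℤ) * ((t : ℤ) - 1) + b₀ := by ring
      rw [this]
      have h1 : (0 : ℤ) ≤ (a : ℤ) * ((t : ℤ) - 1) :=
        mul_nonneg (by positivity) (sub_nonneg.mpr (by exact_mod_cast ht1))
      have h2 : (1 : ℤ) ≤ b₀ := by exact_mod_cast hb₀1
      linarith
  -- the injection `n ↦ k + 1`
  set S := (Icc 1 T).filter fun t : ℕ =>
    (((q : ℤ) * t + ((r : ℤ) - q)) * ((a : ℤ) * t + ((b₀ : ℤ) - a))).natAbs.Coprime P with hS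
  have hcard : #D ≤ #S := by
    refine Finset.card_le_card_of_injOn (fun n => (n / c₁ - r) / q + 1) (fun n hn => ?_) ?_
    · obtain ⟨k, hnk, hkN, hcp1, hcp2, -⟩ := hstruct n hn
      have hdiv : n / c₁ = r + q * k := by rw [hnk, Nat.mul_div_cancel_left _ (by omega)]
      have hk : (n / c₁ - r) / q = k := by
        rw [hdiv, Nat.add_sub_cancel_left, Nat.mul_div_cancel_left _ (by omega)]
      simp only [Finset.coe_filter, Set.mem_setOf_eq, hS, Finset.mem_Icc]
      rw [hk]
      refine ⟨⟨by omega, by rw [hT]; omega⟩, ?_⟩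
      have hval : ((q : ℤ) * ((k + 1 : ℕ) : ℤ) + ((r : ℤ) - q)) * ((a : ℤ) * ((k + 1 : ℕ) : ℤ) +
          ((b₀ : ℤ) - a)) = ((r + q * k : ℕ) : ℤ) * ((b₀ + a * k : ℕ) : ℤ) := by
        push_cast; ring
      rw [hval, ← Nat.cast_mul, Int.natAbs_natCast]
      exact Nat.Coprime.mul_left hcp1 hcp2
    · intro n₁ hn₁ n₂ hn₂ heq
      obtain ⟨k₁, hnk₁, -, -, -, -⟩ := hstruct n₁ (by simpa using hn₁)
      obtain ⟨k₂, hnk₂, -, -, -, -⟩ := hstruct n₂ (by simpa using hn₂)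
      have hd₁ : n₁ / c₁ = r + q * k₁ := by rw [hnk₁, Nat.mul_div_cancel_left _ (by omega)]
      have hd₂ : n₂ / c₁ = r + q * k₂ := by rw [hnk₂, Nat.mul_div_cancel_left _ (by omega)]
      have h1 : (n₁ / c₁ - r) / q = k₁ := by
        rw [hd₁, Nat.add_sub_cancel_left, Nat.mul_div_cancel_left _ (by omega)]
      have h2 : (n₂ / c₁ - r) / q = k₂ := by
        rw [hd₂, Nat.add_sub_cancel_left, Nat.mul_div_cancel_left _ (by omega)]
      simp only [h1, h2] at heq
      have : k₁ = k₂ := by omega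
      rw [hnk₁, hnk₂, this]
  -- the size of `T`
  have hTle : (T : ℝ) ≤ (N : ℝ) * G / ((c₁ : ℝ) * c₂) + 1 := by
    rw [hT]
    push_cast
    refine add_le_add ?_ le_rfl
    have hc₁0 : (0 : ℝ) < c₁ := by exact_mod_cast hc₁
    have hq0 : (0 : ℝ) < q := by exact_mod_cast hq1
    have hG0 : (0 : ℝ) < G := by exact_mod_cast hG
    have h1 : ((N / (c₁ * q) : ℕ) : ℝ) ≤ (N : ℝ) / ((c₁ : ℝ) * q) := by
      rw [le_div_iff₀ (by positivity)]
      exact_mod_cast Nat.div_mul_le_self N (c₁ * q)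
    have h2 : (N : ℝ) / ((c₁ : ℝ) * q) = (N : ℝ) * G / ((c₁ : ℝ) * c₂) := by
      rw [hq]; push_cast
      field_simp
    linarith
  -- assemble
  have hprod0 : 0 ≤ (∏ p ∈ P.primeFactors, (1 - 2 / (p : ℝ))) *
      ∏ p ∈ P.primeFactors.filter (· ∣ h * m * c₁ * c₂), (((p : ℝ) - 1) / ((p : ℝ) - 2)) := by
    have hp3 : ∀ p ∈ P.primeFactors, (3 : ℝ) ≤ p := by
      intro p hp
      obtain ⟨hpp, hpd⟩ := hprimeP p hp
      have h2 : p ≠ 2 := by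
        rintro rfl
        exact (Nat.not_even_iff_odd.mpr hPodd) (even_iff_two_dvd.mpr hpd)
      exact_mod_cast (Nat.succ_le_of_lt (lt_of_le_of_ne hpp.two_le (Ne.symm h2)))
    refine mul_nonneg (Finset.prod_nonneg fun p hp => ?_) (Finset.prod_nonneg fun p hp => ?_)
    · have := hp3 p hp
      rw [sub_nonneg, div_le_one (by linarith)]; linarith
    · have := hp3 p (Finset.mem_filter.mp hp).1
      exact div_nonneg (by linarith) (by linarith)
  calc (#D : ℝ) ≤ #S := by exact_mod_cast hcard
    _ ≤ _ := hsieve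
    _ ≤ _ := by
        have := mul_le_mul_of_nonneg_right hTle (mul_nonneg hC₀.le hprod0)
        nlinarith [this, hprod0, hC₀]


end PairShiuCount

end Literature.NumberTheory.Sieve
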